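import Mathlib
import Summits.NavierStokesRegularity.NavierStokesRegularity.Theses.TaoLadderRungTwoBreak
import HarnessLib

/-!
# `TaoLadderRungTwoBreak.Assembly` — the route's (rev-1) assembly (item stmt-NavierStokesRegularity-20207;
  pure logic)

**Statement.** `NoSurvivingDSSOne → BlowupRigidityOne → Target`.

PROOF (the route's rev-1 glue, kernel-checked by the cell referee c26 as `assembly_20207_old_glue`;
the route has since been re-glued through `NoSurvivingEternalViscBddOne` / `EternalRigidityViscBddOne`,
which does not affect this implication): given `R ≥ 1`, `NoSurvivingDSSOne` and `BlowupRigidityOne`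
provide thresholds `ε₁, ε₂ > 0`; below `min ε₁ ε₂` a robust blow-up would, by rigidity, yield a
surviving DSS lattice wave, which the Liouville hypothesis excludes.

HONEST FRAMING: glue between the route's own statements about MODEL lattices (Tao 2016's cascade
class; rung leaf TL-M2Break, D-0061); nothing here is a statement about the Navier–Stokes equations.
-/

noncomputable section

set_option linter.dupNamespace false

namespace Summit.NavierStokesRegularity.NavierStokesRegularity.Theorems

open Summit.NavierStokesRegularity.NavierStokesRegularity.Theses.TaoLadderRungTwoBreak in
/-- **Item stmt-NavierStokesRegularity-20207** (`TaoLadderRungTwoBreak.Assembly`): the rev-1 cruxes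
`NoSurvivingDSSOne` and `BlowupRigidityOne` imply the registered rung leaf `Target` (thresholds
combined by `min`). [this file] -/
theorem taoLadderRungTwoBreak_assembly_proof :
    Summit.NavierStokesRegularity.NavierStokesRegularity.Theses.TaoLadderRungTwoBreak.Assembly := by
  unfold Summit.NavierStokesRegularity.NavierStokesRegularity.Theses.TaoLadderRungTwoBreak.Assembly
  intro h₁ h₂ R hR
  obtain ⟨ε₁, hε₁, H1⟩ := h₁ R hR
  obtain ⟨ε₂, hε₂, H2⟩ := h₂ R hR
  refine ⟨min ε₁ ε₂, lt_min hε₁ hε₂, fun ε₀ hε₀ hle α X₀ hα hNG => ?_⟩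
  obtain ⟨q, π, T, Φ, hW, hS, r, x, hne⟩ :=
    H2 ε₀ hε₀ (hle.trans (min_le_right _ _)) α X₀ hα hNG
  exact hne (H1 ε₀ hε₀ (hle.trans (min_le_left _ _)) α hα q π T Φ hW hS r x)

end Summit.NavierStokesRegularity.NavierStokesRegularity.Theorems

end
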